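import Literature.MathematicalPhysics.QuantumLattice.HubbardInteractionMoments
import Literature.MathematicalPhysics.QuantumLattice.HubbardEffectiveActionCT
import Literature.MathematicalPhysics.QuantumLattice.SymmetricRegimeFunctionals
import Literature.MathematicalPhysics.QuantumLattice.GrassmannKernelsPresented
import HarnessLib

/-!
# The quartic kernel of the Hubbard vertex in momentum space: the bare value `𝒱₄ = U`

Topic `MathematicalPhysics/QuantumLattice`; companion of `HubbardInteractionMoments` (`hubbardInteraction_eq_sum_smul`:
`V = Σ_κ [cons κ]·U(βL²)⁻³ • ψ̂⁺_{κ₀↑}ψ̂⁻_{κ₁↑}ψ̂⁺_{κ₂↓}ψ̂⁻_{κ₃↓}`, BGM 2006 (2.6a)) and of `SymmetricRegimeFunctionals`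
(Salmhofer's vertex functions `𝒱_m = m!·(βL²)^{m-1}·kernel`, Salmhofer 1998 §5.1: "the bare Hubbard interaction `𝒱₄ = U`").
The kernels of the momentum-space vertex `V` (and of the countertermed vertex `V_K = V + 𝒩_K` of `HubbardEffectiveActionCT`) are put in
closed form at the leg strings of the vertex monomials:

* `vertexLegs κ` — the leg string `((κ₀,↑),+), ((κ₁,↑),−), ((κ₂,↓),+), ((κ₃,↓),−)`; `vertexMonomial_eq_genProd`;
* `deltaMatrix_vertexLegs`, `det_deltaMatrix_vertexLegs` — two leg strings overlap slot by slot (the four `(spin, charge)` types are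
  distinct), so their delta determinant is `[κ′ = κ]`;
* **`kernel_hubbardInteraction_vertexLegs_comp_perm`** — `kernel V 4 (vertexLegs κ ∘ σ) = sign σ · [cons κ] · U(βL²)⁻³/4!`;
  `kernel_hubbardInteraction_of_ne_four`, `kernel_counterQuadratic_of_ne_two`, `kernel_hubbardInteractionCT_four`;
* **`vertexFn_hubbardInteractionCT_vertexLegs`** — `𝒱₄(V_K)(vertexLegs κ) = [cons κ]·U` (`β ≠ 0`): the bare value;
* **`vertexFn_hubbardInteractionCT_pairLegs`** — at the pair labels `(ω₀k′↑+), (−ω₀,Q−k′,↓+), (−ω₀,Q−k,↓−), (ω₀k↑−)` of the Cooper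
  channel (total lattice momentum `Q`, lowest frequencies; an even permutation of a conserving leg string) the value is `U` EXACTLY, for
  every `Q, k, k′` — the ultraviolet datum `𝒞 = U + O(U²)` of the pair amplitude starts from.

Everything is proved; the two definitions (`vertexLegs`, `pairLegs`) are bookkeeping; no named facts.

## Sources

G. Benfatto, A. Giuliani, V. Mastropietro, Ann. Henri Poincaré 7 (2006) 809–898, §2.1 (2.6a) [`BenfattoGiulianiMastropietro2006`];
M. Salmhofer, Comm. Math. Phys. 194 (1998) 249–295, §5.1 [`Salmhofer1998`].
-/

noncomputable section

namespace Literature.MathematicalPhysics.QuantumLattice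

open GrassmannAlgebra Finset Literature.Probability.LatticeModels

section VertexLegs

variable (L M : ℕ)

/-- **The leg string of the vertex monomial** with momentum labels `κ`: `((κ₀,↑),+), ((κ₁,↑),−), ((κ₂,↓),+), ((κ₃,↓),−)`
(`psiPlus k σ = ψ((k,σ),0)`, `psiMinus k σ = ψ((k,σ),1)`). [cite: BenfattoGiulianiMastropietro2006, §2.1 (2.6a)] -/
def vertexLegs (κ : Fin 4 → FreqMomentum L M) : Fin 4 → HubbardFieldIdx L M :=
  ![((κ 0, 0), 0), ((κ 1, 0), 1), ((κ 2, 1), 0), ((κ 3, 1), 1)]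

variable {L M}

/-- The vertex monomial is the generator product of its leg string. [cite: BenfattoGiulianiMastropietro2006, §2.1 (2.6a)] -/
theorem vertexMonomial_eq_genProd (κ : Fin 4 → FreqMomentum L M) :
    vertexMonomial L M κ = genProd ℂ (vertexLegs L M κ) := by
  rw [vertexMonomial, vertexLegs, genProd_succ, genProd_succ, genProd_succ, genProd_succ, genProd_zero, mul_one]
  simp only [mul_assoc]
  rfl

/-- **Two leg strings overlap slot by slot**: `[vertexLegs κ′ i = vertexLegs κ j] = [i = j]·[κ′ i = κ i]` — the delta matrix of two
leg strings is diagonal (the four `(spin, charge)` types are pairwise distinct). [cite: BenfattoGiulianiMastropietro2006, §2.1 (2.6a)] -/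
theorem deltaMatrix_vertexLegs (κ' κ : Fin 4 → FreqMomentum L M) :
    deltaMatrix ℂ (vertexLegs L M κ') (vertexLegs L M κ) = Matrix.diagonal fun i => if κ' i = κ i then 1 else 0 := by
  ext i j
  rw [deltaMatrix_apply, Matrix.diagonal_apply]
  fin_cases i <;> fin_cases j <;> simp [vertexLegs]

/-- Hence `det [vertexLegs κ′ i = vertexLegs κ j] = [κ′ = κ]`. [cite: BenfattoGiulianiMastropietro2006, §2.1 (2.6a)] -/
theorem det_deltaMatrix_vertexLegs (κ' κ : Fin 4 → FreqMomentum L M) :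
    (deltaMatrix ℂ (vertexLegs L M κ') (vertexLegs L M κ)).det = if κ' = κ then 1 else 0 := by
  rw [deltaMatrix_vertexLegs, Matrix.det_diagonal]
  by_cases h : κ' = κ
  · subst h
    simp
  · rw [if_neg h]
    obtain ⟨i, hi⟩ := Function.ne_iff.1 h
    exact prod_eq_zero (mem_univ i) (if_neg hi)

/-- The delta matrix of a permuted leg string is the row-permuted delta matrix (antisymmetry of the kernels, Salmhofer 1999 (4.95)).
[cite: Salmhofer1999, §4.3 (4.95)] -/
theorem deltaMatrix_comp_perm {Γ : Type*} [DecidableEq Γ] {m : ℕ} (X Y : Fin m → Γ) (σ : Equiv.Perm (Fin m)) :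
    deltaMatrix ℂ (X ∘ σ) Y = (deltaMatrix ℂ X Y).submatrix σ id := by
  ext i j
  simp [deltaMatrix_apply]

/-! ### The quartic kernel of `V` at (permuted) leg strings -/

/-- **The quartic kernel of the Hubbard vertex at a permuted leg string**:
`kernel V 4 (vertexLegs κ ∘ σ) = sign σ · [cons κ]·U(βL²)⁻³ · (4!)⁻¹` — of the sum over vertex monomials exactly the one with labels
`κ` overlaps, with the sign of the reordering. [cite: BenfattoGiulianiMastropietro2006, §2.1 (2.6a)] -/
theorem kernel_hubbardInteraction_vertexLegs_comp_perm [NeZero L] (β U : ℝ) (κ : Fin 4 → FreqMomentum L M)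
    (σ : Equiv.Perm (Fin 4)) :
    kernel ℂ (hubbardInteraction L M β U) 4 (vertexLegs L M κ ∘ σ) =
      (Equiv.Perm.sign σ : ℂ) * (if vertexConserving L M κ then (((U / (β * (L : ℝ) ^ 2) ^ 3 : ℝ)) : ℂ) else 0) *
        (((4 : ℕ).factorial : ℚ)⁻¹ • (1 : ℂ)) := by
  rw [hubbardInteraction_eq_sum_smul, kernel_sum]
  have hterm : ∀ κ₁ : Fin 4 → FreqMomentum L M,
      kernel ℂ ((if vertexConserving L M κ₁ then (((U / (β * (L : ℝ) ^ 2) ^ 3 : ℝ)) : ℂ) else 0) • vertexMonomial L M κ₁) 4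
          (vertexLegs L M κ ∘ σ) =
        if κ = κ₁ then (Equiv.Perm.sign σ : ℂ) * (if vertexConserving L M κ then (((U / (β * (L : ℝ) ^ 2) ^ 3 : ℝ)) : ℂ) else 0) *
          (((4 : ℕ).factorial : ℚ)⁻¹ • (1 : ℂ)) else 0 := by
    intro κ₁
    rw [kernel_smul, vertexMonomial_eq_genProd, kernel_genProd, deltaMatrix_comp_perm, Matrix.det_permute,
      det_deltaMatrix_vertexLegs]
    by_cases h : κ = κ₁
    · subst h
      simp only [if_true]
      ring
    · rw [if_neg h, if_neg h, mul_zero, mul_zero, mul_zero]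
  simp_rw [hterm]
  rw [sum_ite_eq univ κ, if_pos (mem_univ κ)]

/-- The quartic kernel at an unpermuted leg string: `kernel V 4 (vertexLegs κ) = [cons κ]·U(βL²)⁻³·(4!)⁻¹`.
[cite: BenfattoGiulianiMastropietro2006, §2.1 (2.6a)] -/
theorem kernel_hubbardInteraction_vertexLegs [NeZero L] (β U : ℝ) (κ : Fin 4 → FreqMomentum L M) :
    kernel ℂ (hubbardInteraction L M β U) 4 (vertexLegs L M κ) =
      (if vertexConserving L M κ then (((U / (β * (L : ℝ) ^ 2) ^ 3 : ℝ)) : ℂ) else 0) * (((4 : ℕ).factorial : ℚ)⁻¹ • (1 : ℂ)) := by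
  have h := kernel_hubbardInteraction_vertexLegs_comp_perm β U κ 1
  rw [Equiv.Perm.sign_one, Units.val_one, Int.cast_one, one_mul] at h
  simpa using h

/-- The Hubbard vertex has kernels only in degree `4`. [cite: BenfattoGiulianiMastropietro2006, §2.1 (2.6a)] -/
theorem kernel_hubbardInteraction_of_ne_four [NeZero L] (β U : ℝ) {m : ℕ} (hm : m ≠ 4) (X : Fin m → HubbardFieldIdx L M) :
    kernel ℂ (hubbardInteraction L M β U) m X = 0 := by
  rw [hubbardInteraction_eq_sum_smul, kernel_sum]
  refine sum_eq_zero fun κ₁ _ => ?_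
  rw [kernel_smul, vertexMonomial_eq_genProd, kernel_genProd_of_ne ℂ X _ hm, mul_zero]

/-- The counterterm vertex `𝒩_K` has kernels only in degree `2`. [cite: BenfattoGiulianiMastropietro2003, §1.2 The model (2.10)] -/
theorem kernel_counterQuadratic_of_ne_two [NeZero L] (β : ℝ) (K : TrigPolyC4v) {m : ℕ} (hm : m ≠ 2)
    (X : Fin m → HubbardFieldIdx L M) : kernel ℂ (counterQuadratic L M β K) m X = 0 := by
  rw [counterQuadratic, kernel_sum]
  refine sum_eq_zero fun k _ => ?_
  rw [kernel_sum]
  refine sum_eq_zero fun s _ => ?_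
  have hgen : psiPlus k s * psiMinus k s = genProd ℂ (![((k, s), 0), ((k, s), 1)] : Fin 2 → HubbardFieldIdx L M) := by
    rw [genProd_succ, genProd_succ, genProd_zero, mul_one]
    rfl
  rw [kernel_smul, hgen, kernel_genProd_of_ne ℂ X _ hm, mul_zero]

/-- **The countertermed vertex has the same quartic kernel as the bare vertex**: `kernel (V + 𝒩_K) 4 = kernel V 4`.
[cite: BenfattoGiulianiMastropietro2003, §1.2 The model (2.10)] -/
theorem kernel_hubbardInteractionCT_four [NeZero L] (β U : ℝ) (K : TrigPolyC4v) (X : Fin 4 → HubbardFieldIdx L M) :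
    kernel ℂ (hubbardInteractionCT L M β U K) 4 X = kernel ℂ (hubbardInteraction L M β U) 4 X := by
  rw [hubbardInteractionCT, kernel_add, kernel_counterQuadratic_of_ne_two β K (by norm_num) X, add_zero]

/-! ### The bare value of Salmhofer's quartic vertex function -/

/-- **The bare value `𝒱₄ = U`**: at a leg string, `𝒱₄(V_K)(vertexLegs κ) = 4!·(βL²)³·kernel = [cons κ]·U` (`β ≠ 0`).
[cite: Salmhofer1998, §5.1] -/
theorem vertexFn_hubbardInteractionCT_vertexLegs_comp_perm [NeZero L] {β : ℝ} (hβ : β ≠ 0) (U : ℝ) (K : TrigPolyC4v)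
    (κ : Fin 4 → FreqMomentum L M) (σ : Equiv.Perm (Fin 4)) :
    vertexFn L M β (hubbardInteractionCT L M β U K) 4 (vertexLegs L M κ ∘ σ) =
      (Equiv.Perm.sign σ : ℂ) * (if vertexConserving L M κ then (U : ℂ) else 0) := by
  rw [vertexFn_def, kernel_hubbardInteractionCT_four, kernel_hubbardInteraction_vertexLegs_comp_perm]
  have h24 : ((4 : ℕ).factorial : ℝ) = 24 := by norm_num [Nat.factorial]
  have h24q : (((4 : ℕ).factorial : ℚ)⁻¹ • (1 : ℂ)) = ((24 : ℂ))⁻¹ := by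
    rw [Rat.smul_one_eq_cast]
    norm_num [Nat.factorial]
  rw [h24q, show (4 : ℕ) - 1 = 3 from rfl, h24]
  split_ifs with hc
  · have hc' : (((U / (β * (L : ℝ) ^ 2) ^ 3 : ℝ)) : ℂ) = (U : ℂ) / ((((β * (L : ℝ) ^ 2) ^ 3 : ℝ)) : ℂ) := by push_cast; ring
    have hβc : (β : ℂ) ≠ 0 := by exact_mod_cast hβ
    have hLc : ((L : ℕ) : ℂ) ≠ 0 := by exact_mod_cast NeZero.ne L
    rw [hc']
    push_cast
    field_simp
  · simp

/-- The bare value at an unpermuted leg string: `𝒱₄(V_K)(vertexLegs κ) = [cons κ]·U`. [cite: Salmhofer1998, §5.1] -/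
theorem vertexFn_hubbardInteractionCT_vertexLegs [NeZero L] {β : ℝ} (hβ : β ≠ 0) (U : ℝ) (K : TrigPolyC4v)
    (κ : Fin 4 → FreqMomentum L M) :
    vertexFn L M β (hubbardInteractionCT L M β U K) 4 (vertexLegs L M κ) = if vertexConserving L M κ then (U : ℂ) else 0 := by
  have h := vertexFn_hubbardInteractionCT_vertexLegs_comp_perm hβ U K κ 1
  rw [Equiv.Perm.sign_one, Units.val_one, Int.cast_one, one_mul] at h
  simpa using h

/-! ### The pair labels of the Cooper channel -/

variable (L M) in
/-- **The pair labels** `(ω₀,k′,↑,+), (−ω₀,Q−k′,↓,+), (−ω₀,Q−k,↓,−), (ω₀,k,↑,−)` at total lattice momentum `Q` and the lowest Matsubara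
frequencies: the label string at which the pair amplitude `𝒞(Q; k, k′) = 𝒱₄(…)` of the Cooper channel is read.
[cite: BenfattoGiulianiMastropietro2006, §2.1 (2.6a)] -/
def pairLegs [NeZero M] (Q k k' : TorusSite 2 L) : Fin 4 → HubbardFieldIdx L M :=
  ![(((omega0 M, k'), 0), 0), ((((omega0 M).rev, Q - k'), 1), 0), ((((omega0 M).rev, Q - k), 1), 1), (((omega0 M, k), 0), 1)]

/-- The reordering `0 ↦ 0, 1 ↦ 2, 2 ↦ 3, 3 ↦ 1` taking a leg string to the pair labels. [cite: BenfattoGiulianiMastropietro2006, §2.1 (2.6a)] -/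
def pairLegsPerm : Equiv.Perm (Fin 4) := Equiv.swap (1 : Fin 4) 2 * Equiv.swap (2 : Fin 4) 3

/-- The reordering is even (a `3`-cycle). [cite: BenfattoGiulianiMastropietro2006, §2.1 (2.6a)] -/
theorem sign_pairLegsPerm : Equiv.Perm.sign pairLegsPerm = 1 := by
  unfold pairLegsPerm
  decide

/-- Its values. [cite: BenfattoGiulianiMastropietro2006, §2.1 (2.6a)] -/
theorem pairLegsPerm_apply :
    pairLegsPerm 0 = 0 ∧ pairLegsPerm 1 = 2 ∧ pairLegsPerm 2 = 3 ∧ pairLegsPerm 3 = 1 := by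
  unfold pairLegsPerm
  decide

/-- **The pair labels are an even reordering of a conserving leg string**: with
`κ⋆ = ((ω₀,k′), (ω₀,k), (−ω₀,Q−k′), (−ω₀,Q−k))`, `pairLegs Q k k′ = vertexLegs κ⋆ ∘ pairLegsPerm`.
[cite: BenfattoGiulianiMastropietro2006, §2.1 (2.6a)] -/
theorem pairLegs_eq_vertexLegs_comp [NeZero M] (Q k k' : TorusSite 2 L) :
    pairLegs L M Q k k' =
      vertexLegs L M ![(omega0 M, k'), (omega0 M, k), ((omega0 M).rev, Q - k'), ((omega0 M).rev, Q - k)] ∘ pairLegsPerm := by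
  obtain ⟨h0, h1, h2, h3⟩ := pairLegsPerm_apply
  funext i
  fin_cases i
  · simp [h0, pairLegs, vertexLegs]
  · simp [h1, pairLegs, vertexLegs]
  · simp [h2, pairLegs, vertexLegs]
  · simp [h3, pairLegs, vertexLegs]

/-- The leg string behind the pair labels conserves frequency and momentum (`ω₀ + (−ω₀) = ω₀ + (−ω₀)`, `k′ + (Q−k′) = k + (Q−k)`: the constraint of BGM 2006 (2.6a)).
[cite: BenfattoGiulianiMastropietro2006, §2.1 (2.6a)] -/
theorem vertexConserving_pairLegs [NeZero M] (Q k k' : TorusSite 2 L) :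
    vertexConserving L M ![(omega0 M, k'), (omega0 M, k), ((omega0 M).rev, Q - k'), ((omega0 M).rev, Q - k)] := by
  refine ⟨rfl, ?_⟩
  show k' + (Q - k') = k + (Q - k)
  abel

/-- **The bare pair amplitude is `U`**: `𝒱₄(V_K)(pairLegs Q k k′) = U` for every total momentum `Q` and every `k, k′` (`β ≠ 0`) — the
ultraviolet starting value of the Cooper-channel pair amplitude `𝒞(Q; k, k′)`. [cite: Salmhofer1998, §5.1] -/
theorem vertexFn_hubbardInteractionCT_pairLegs [NeZero L] [NeZero M] {β : ℝ} (hβ : β ≠ 0) (U : ℝ) (K : TrigPolyC4v)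
    (Q k k' : TorusSite 2 L) :
    vertexFn L M β (hubbardInteractionCT L M β U K) 4 (pairLegs L M Q k k') = U := by
  rw [pairLegs_eq_vertexLegs_comp, vertexFn_hubbardInteractionCT_vertexLegs_comp_perm hβ, sign_pairLegsPerm,
    if_pos (vertexConserving_pairLegs Q k k')]
  simp

/-- The same for the bare vertex `V` (frame `K = 0`). [cite: Salmhofer1998, §5.1] -/
theorem vertexFn_hubbardInteraction_pairLegs [NeZero L] [NeZero M] {β : ℝ} (hβ : β ≠ 0) (U : ℝ) (Q k k' : TorusSite 2 L) :
    vertexFn L M β (hubbardInteraction L M β U) 4 (pairLegs L M Q k k') = U := by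
  have h := vertexFn_hubbardInteractionCT_pairLegs (L := L) (M := M) hβ U 0 Q k k'
  rwa [hubbardInteractionCT, counterQuadratic_zero, add_zero] at h

end VertexLegs

end Literature.MathematicalPhysics.QuantumLattice

end
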